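import Mathlib.Analysis.Complex.Basic
import Mathlib.Algebra.CharP.Defs
import Literature.Computability.AlgebraicComplexity.ArithCircuit
import Literature.Computability.AlgebraicComplexity.ValiantClasses
import Literature.Computability.AlgebraicComplexity.StandardFamilies
import HarnessLib
import HarnessLib.Audit

-- provenance: harness21/H21/H21/Statements/PNP/ValiantConjecture.lean @ fb9c2df (interim HEAD d8f2665); M5 mechanical rewrite
-- verdict clean-up: `VPNeVNPComplex` / `PerNotPComputableComplex` re-read against the held sources
-- (Bürgisser–Clausen–Shokrollahi 1997, (21.19) and Problem 21.4; von zur Gathen 1987, §2, §4 with Prop. 4.8,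
-- Thm. 5.4; Bürgisser 2024, arXiv:2406.06217, §2.6–§2.8) and registered as OPEN statements (docstrings
-- `OPEN CONJECTURE — … [status: open]`; names and statements unchanged, see the module docstring "Registry")
-- (literature-prover-defact-Computability-AlgebraicComplexity-Va-ae6ae27e-0, 2026-08-15)
/-!
# Valiant's hypothesis `VP ≠ VNP` and completeness of the permanent (family PNP)

Target statements of the algebraic (Valiant) branch of the `P` vs `NP` family:

* **pnp.S03** Valiant's hypothesis `VP_k ≠ VNP_k`, in particular over `ℂ`
  (`ValiantHypothesis`; over `ℂ` the canonical `@[conjecture]` is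
  `Summit.PneNP.PneNP.VPNeVNPComplex`, `Summits/PneNP/PneNP/Theorems/VPNeVNPComplex.lean`, a
  conjecture LEAF importing this file — conjecture/notion split 2026-08-15), an open conjecture;
* **pnp.S04** "the permanent is not p-computable over `ℂ`": there is no constant `c` with
  `L_ℂ(PER_n) ≤ n ^ c + c` for all `n` (`PerNotPComputableComplex`), a `def … : Prop`, together
  with its literal unfolding; its (known) equivalence with **pnp.S03** over `ℂ` is PROVED in the
  sibling files (`perNotPComputableComplex_iff_holds`, `ValiantConjectureEquivProofs.lean`, in
  unfolded form; `perNotPComputableComplex_iff`, `ValiantConjectureConsequences.lean`, over the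
  canonical conjecture — that file may import the leaf, this one may not);
* **pnp.S25** Valiant's completeness theorems: `HC` is `VNP`-complete over every field, `PER` is
  `VNP`-complete over fields of characteristic `≠ 2`, and `DET ∈ VP` (known theorems, vendored as
  named facts `def … : Prop`, D-0014; all of them are now discharged by `…_holds` theorems in the
  sibling files `ValiantHCCompleteness.lean`, `ValiantCompleteness.lean`, `DetInVP.lean`,
  `ValiantConjectureProofs.lean`, `HamiltonianCycleVNP.lean`).

## Sources

* L. G. Valiant, *Completeness classes in algebra*, STOC 1979.
* P. Bürgisser, *Completeness and Reduction in Algebraic Complexity Theory*, Springer 2000,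
  Definitions 2.1–2.5, Theorem 2.10, Remark 2.11, Proposition 2.30.
* P. Bürgisser, M. Clausen, M. A. Shokrollahi, *Algebraic Complexity Theory*, Springer 1997
  (Grundlehren 315), Ch. 21: (21.19) Valiant's Hypothesis, Thm. (21.17), §21.7 Problem 21.4.
* J. von zur Gathen, *Feasible arithmetic computations: Valiant's hypothesis*, J. Symb. Comput. 4
  (1987) 137–172, §2, §4 (Def. 4.7, Prop. 4.8), §5 (Thm. 5.4, Cor. 5.7).
* P. Bürgisser, *Completeness classes in algebraic complexity theory*, arXiv:2406.06217 (2024),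
  §2.6 (Valiant's conjecture, Rem. 2.26), §2.7 (Thm. 2.29), §2.8.

## Design choices

* All notions (`VP`, `VNP`, `IsPComputable`, `IsVNPComplete`, `complexity`, `perPoly`, `detPoly`,
  `hcPoly`, `detFamily`) come from the `CplxAlg` prelude; this file only assembles statements.
  We use the prelude names `perPoly`/`detPoly`/`hcPoly` (not `Literature.Computability.Complexity.per`).
* Conjectures (**pnp.S03**, **pnp.S04**) are `def … : Prop` only, like Mathlib's
  `RiemannHypothesis`; no theorem asserts them (registered OPEN statements, see "Registry" below).
  Their equivalence over `ℂ` is a theorem in print (von zur Gathen 1987, Prop. 4.8 with Thm. 5.4;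
  Bürgisser 2000, Rem. 2.11) and in the tree (`perNotPComputableComplex_iff_holds`,
  `ValiantConjectureEquivProofs.lean`; packaged over the canonical conjecture as
  `perNotPComputableComplex_iff` in `ValiantConjectureConsequences.lean`). No declaration of THIS
  file mentions the conjecture `VP ℂ ≠ VNP ℂ` by name: the conjecture leaf imports this file for
  its vocabulary, so everything that needs the conjecture's name lives downstream of the leaf.
* Mathlib has no Valiant classes, permanent-completeness or `VP ≠ VNP` statement (searched
  `Valiant`, `VNP`, `permanent`: only `Matrix.permanent` exists and is used via `perPoly`).

## Registry: `VPNeVNPComplex`, `PerNotPComputableComplex` are OPEN statements (verdict clean-up 2026-08-15)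

Both closed `Prop`s were seated as named facts, and their tenured prove-seats returned the verdict
*open problem*. Re-read against the held sources:

* `VPNeVNPComplex := VP ℂ ≠ VNP ℂ` is Valiant's hypothesis in characteristic `0`, the summit
  statement itself: `ValiantsHypothesis := Literature.PNP.ValiantHypothesis ℂ := VP ℂ ≠ VNP ℂ`
  (`Summits/ValiantsHypothesis/ValiantsHypothesis/Statement.lean`, definitionally this `Prop`). It is
  POSED, never proved, in: Bürgisser–Clausen–Shokrollahi 1997, §21.1, "(21.19) Valiant's Hypothesis.
  `VP ≠ VNP` over any field." (p. 549) and §21.7 "Problem 21.4. Is Valiant's hypothesis true?";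
  von zur Gathen 1987, §2 and §4: "Valiant's hypothesis. Over any field `F`, there exist p-definable
  families of polynomials that are not p-computable" ("our civilisation does not seem ready for
  proofs of Valiant's hypothesis", §2); Bürgisser 2024, §2.6 (after Def. 2.25): "Valiant's
  conjecture. We have `VP^F ≠ VNP^F` over any field `F`. This fundamental conjecture is widely open
  and considered the holy grail of algebraic complexity theory", Rem. 2.26(2): its truth depends
  only on the characteristic of `F` (Bürgisser 2000). With `VP ⊆ VNP` (BCS 1997, after Def. (21.21):
  "Obviously, `VP_e ⊆ VP ⊆ VNP`"; `VP_subset_VNP`, discharged by `VP_subset_VNP_holds`) von zur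
  Gathen's form is `VP ≠ VNP`.
* `PerNotPComputableComplex := ¬ IsPComputable (PER_n)_n` over `ℂ` is the standard equivalent form
  of the same conjecture: von zur Gathen 1987, §2: "PER is p-complete, and thus Valiant's hypothesis
  is equivalent to the conjecture that PER is not p-computable (over a field of characteristic
  different from two …)", Prop. 4.8 with Thm. 5.4 and Cor. 5.7; BCS 1997, Thm. (21.17) with
  Rem. (21.13)(2) and Def. (21.14); Bürgisser 2024, §2.7 Thm. 2.29 and §2.8: "Valiant's conjecture
  is equivalent to proving `(f_n) ∉ VP` for any such `VNP`-complete sequence". In the tree the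
  equivalence is PROVED (`perNotPComputableComplex_iff_holds`, `ValiantConjectureEquivProofs.lean`;
  `perNotPComputableComplex_iff`, `ValiantConjectureConsequences.lean`), so a proof of either
  `Prop` settles the summit `ValiantsHypothesis`.
* Accordingly both are *registered open statements* (CONVENTIONS §4: an open conjecture is a
  `def … : Prop`, never asserted): their docstrings begin `OPEN CONJECTURE —`, cite where the
  conjecture is posed, and carry `[status: open]`; no `…_holds` theorem is to be expected, and users
  take them as explicit hypotheses `(h : VPNeVNPComplex)`. The statements are byte-for-byte
  unchanged; `PerNotPComputableComplex` keeps its name and is used by it in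
  `ValiantConjectureEquivProofs.lean`, `ValiantConjectureConsequences.lean` and
  `RazElusiveGeneralExistence.lean` (`raz_elusive_curve ↔ PerNotPComputableComplex`), while
  `VP ℂ ≠ VNP ℂ` is referred to downstream by its canonical name `Summit.PneNP.PneNP.VPNeVNPComplex`
  (`ValiantConjectureCompleteCriterion.lean`: `VPNeVNPComplex_iff_not_isPComputable_hcPoly`,
  `VPNeVNPComplex_iff_perFamily_not_mem_VP`; `ValiantConjectureConsequences.lean`).

Everything lives in `namespace Literature.Computability.AlgebraicComplexity` (topic-aligned, D-0022),
inside a `noncomputable section`.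
-/

noncomputable section

open Literature.Computability.AlgebraicComplexity

namespace Literature.Computability.AlgebraicComplexity

universe u

/-! ### pnp.S03: Valiant's hypothesis -/

section Valiant

variable (k : Type u) [Field k]

/-- OPEN CONJECTURE — **pnp.S03**, **Valiant's hypothesis over `ℂ`**, the flag statement
`VP_ℂ ≠ VNP_ℂ` (Valiant 1979), posed in Bürgisser–Clausen–Shokrollahi 1997, §21.1, "(21.19) Valiant's
Hypothesis. `VP ≠ VNP` over any field." (p. 549) and listed open there, §21.7, "Problem 21.4. Is
Valiant's hypothesis true?"; von zur Gathen 1987, §4: "Valiant's hypothesis. Over any field `F`, there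
exist p-definable families of polynomials that are not p-computable" (`= VP ≠ VNP` since `VP ⊆ VNP`);
Bürgisser 2000, Def. 2.4–2.5 with Thm. 2.10; Bürgisser 2024 (arXiv:2406.06217), §2.6: "Valiant's
conjecture. We have `VP^F ≠ VNP^F` over any field `F`. This fundamental conjecture is widely open",
Rem. 2.26(2): its truth depends only on the characteristic, so `F = ℂ` is the characteristic-`0` case
[status: open]. The `Prop` `VP ℂ ≠ VNP ℂ`: the class of (bundled) p-computable p-families over `ℂ`
differs from the class of p-definable families over `ℂ` (`VP`, `VNP` of `ValiantClasses.lean`). This is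
definitionally the summit statement `ValiantsHypothesis` (`= Literature.PNP.ValiantHypothesis ℂ`); an
open conjecture recorded as a `def … : Prop` (CONVENTIONS §4), never asserted: no
`VPNeVNPComplex_holds` is to be expected, users take it as a hypothesis `(h : VPNeVNPComplex)`.
Name and statement unchanged (verdict clean-up 2026-08-15, see the module docstring "Registry").
[cite: BurgisserClausenShokrollahi1997, (21.19) p. 549 and Problem 21.4] -/
@[conjecture] def VPNeVNPComplex : Prop :=
  VP ℂ ≠ VNP ℂ

end Valiant

/-! ### pnp.S04: the permanent is not p-computable over `ℂ` -/

/-- OPEN CONJECTURE — **pnp.S04**, **the permanent is not p-computable over `ℂ`**, the standard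
equivalent form of Valiant's hypothesis in characteristic `0`, posed in von zur Gathen 1987, §2: "PER is
p-complete, and thus Valiant's hypothesis is equivalent to the conjecture that PER is not p-computable
(over a field of characteristic different from two; in characteristic two, PER = DET is
p-computable)", with Prop. 4.8 ("Let `f` be a p-complete family over `F`. Then Valiant's hypothesis
holds over `F` if and only if `f` is not p-computable"), Thm. 5.4 (`PER` is p-complete in
characteristic `≠ 2`) and Cor. 5.7; Bürgisser–Clausen–Shokrollahi 1997, (21.19) with Thm. (21.17) and
Problem 21.4; Bürgisser 2000, Def. 2.1–2.2 with Rem. 2.11; Bürgisser 2024 (arXiv:2406.06217), §2.7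
Thm. 2.29 and §2.8: "Valiant's conjecture is equivalent to proving `(f_n) ∉ VP` for any such
`VNP`-complete sequence" [status: open]. The `Prop`: the permanent family `(PER_n)_n`
(`perPoly (Fin n) ℂ`) is not p-computable over `ℂ`, i.e. there is no constant `c` with
`L_ℂ(PER_n) ≤ n ^ c + c` for all `n`, where `L_ℂ` is the arithmetic circuit complexity `complexity`
(`IsPComputable`; literal unfolding `perNotPComputableComplex_iff_forall`). Its equivalence with
Valiant's hypothesis over `ℂ` (`VP ℂ ≠ VNP ℂ`, canonical `@[conjecture]`
`Summit.PneNP.PneNP.VPNeVNPComplex`) is PROVED in the tree (`perNotPComputableComplex_iff_holds`,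
`ValiantConjectureEquivProofs.lean`, unfolded form; `perNotPComputableComplex_iff`,
`ValiantConjectureConsequences.lean`), so a proof of this `Prop` would settle the summit
`ValiantsHypothesis`; an open conjecture recorded as a `def … : Prop`
(CONVENTIONS §4), never asserted: no `PerNotPComputableComplex_holds` is to be expected. Name and
statement unchanged (verdict clean-up 2026-08-15, see the module docstring "Registry").
[cite: Vonzurgathen1987Feasible, §2 and Prop. 4.8 with Thm. 5.4] -/
@[conjecture] def PerNotPComputableComplex : Prop :=
  ¬ IsPComputable fun n => perPoly (Fin n) ℂ

/-- Literal unfolding of **pnp.S04** (Bürgisser 2000, Def. 2.1–2.2): the permanent is not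
p-computable over `ℂ` iff there is no `c : ℕ` with `L_ℂ(PER_n) ≤ n ^ c + c` for all `n`. [cite: Burgisser2000, Def. 2.1–2.2] -/
theorem perNotPComputableComplex_iff_forall :
    PerNotPComputableComplex ↔ ¬ ∃ c : ℕ, ∀ n, complexity (perPoly (Fin n) ℂ) ≤ n ^ c + c :=
  Iff.rfl

/-! ### pnp.S25: Valiant's completeness theorems -/

section Completeness

variable (k : Type u) [Field k]

/-- **pnp.S25** (Valiant 1979; Bürgisser 2000, Thm. 2.10). The Hamiltonian cycle family
`(HC_n)_n` is `VNP`-complete over every field `k`. [cite: Valiant1979] -/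
def isVNPComplete_hcPoly : Prop :=
  IsVNPComplete fun n => hcPoly (Fin n) k

/-- **pnp.S25** (Valiant 1979; Bürgisser 2000, Thm. 2.10). The permanent family `(PER_n)_n` is
`VNP`-complete over every field `k` of characteristic different from `2`. (In characteristic `2`
the permanent equals the determinant, `perPoly_eq_detPoly_of_charP_two`, hence lies in `VP`.) [cite: Valiant1979] -/
def isVNPComplete_perPoly : Prop :=
  ∀ (h2 : ringChar k ≠ 2),
    IsVNPComplete fun n => perPoly (Fin n) k

/-- **pnp.S25** (Valiant 1979; Bürgisser 2000, Prop. 2.30). The determinant family `(DET_n)_n`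
is in `VP` over every field `k`: it is a p-family (`n²` variables, degree `n`) computable by
arithmetic circuits of polynomial size (e.g. by Berkowitz's / Csanky's division-free
algorithms). [cite: Valiant1979] -/
def isVPFamily_detPoly : Prop :=
  IsVPFamily fun n => detPoly (Fin n) k

/-- The bundled determinant family lies in `VP k` (Bürgisser 2000, Prop. 2.30; from
`isVPFamily_detPoly` and `mem_VP_ofFintype_iff`). [cite: Burgisser2000, Prop. 2.30] -/
def detFamily_mem_VP : Prop :=
  detFamily k ∈ VP k

/- interim proof relied on results that are now named facts (D-0014); demoted to a fact by the M5 import, proof preserved: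
:=
  (mem_VP_ofFintype_iff _).2 (isVPFamily_detPoly k)
-/

/-- The permanent family `(PER_n)_n` is p-definable (`∈ VNP`) over every field
(Valiant 1979; Bürgisser 2000, Thm. 2.10 and §2.1: `PER_n = ∑_{e} …` is a Boolean sum of a
`VP` family). No characteristic hypothesis is needed for membership. [cite: Valiant1979] -/
def isVNPFamily_perPoly : Prop :=
  IsVNPFamily fun n => perPoly (Fin n) k

/-- The Hamiltonian cycle family `(HC_n)_n` is p-definable (`∈ VNP`) over every field
(Valiant 1979; Bürgisser 2000, Thm. 2.10). This is the membership half of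
`isVNPComplete_hcPoly`. [cite: Valiant1979] -/
def isVNPFamily_hcPoly : Prop :=
  IsVNPFamily fun n => hcPoly (Fin n) k

/- interim proof relied on results that are now named facts (D-0014); demoted to a fact by the M5 import, proof preserved:
:=
  (isVNPComplete_hcPoly k).1
-/

/-- The bundled permanent family lies in `VNP k` over every field (Valiant 1979;
Bürgisser 2000, Thm. 2.10). [cite: Valiant1979] -/
def perFamily_mem_VNP : Prop :=
  perFamily k ∈ VNP k

/- interim proof relied on results that are now named facts (D-0014); demoted to a fact by the M5 import, proof preserved:
:=
  (mem_VNP_ofFintype_iff _).2 (isVNPFamily_perPoly k)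
-/

end Completeness

end Literature.Computability.AlgebraicComplexity
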